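import Literature.Probability.Percolation.SupercriticalIsoperimetricProfileSurface
import Literature.Probability.Percolation.SupercriticalIsoperimetricProfilePeierls
import Literature.Probability.Percolation.SupercriticalIsoperimetricProfileTwoDim
import Literature.Probability.Percolation.KestenZhangAssembly
import Literature.Probability.Percolation.KestenZhangNoArm
import HarnessLib

/-!
# Isoperimetry of the supercritical cluster (Pete 2008), III: the probability estimate

Topic `Literature/Probability/Percolation`. Theorems only (no definitions, no named facts). The
probability half of the proof of

* [Pete2008] G. Pete, *A note on percolation on `ℤ^d`: isoperimetric profile via exponential
  cluster repulsion*, Electron. Commun. Probab. **13** (2008) 377–392, Theorem 1.2 ("`P_p(∃ S`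
  connected, `o ∈ S ⊂ 𝒞_o`, `M ≤ |S| < ∞`, `|∂⁺_𝒞 S| ≤ α |S|^{1-1/d}) ≤ exp(-c₂ M^{1-1/d})`")
  in the tree's rendering (`SupercriticalIsoperimetricProfileSurface.lean`): the Kesten–Zhang
  block argument run directly on an open-connected set `S` whose OPEN edge boundary is small.

Content:

* `card_filter_supDist_le_two` — at most `5^d` blocks lie at sup-distance `≤ 2` from a block;
* `card_exitPoints_le_ncard` — the points of `S` carrying an open edge leaving `S` are at most
  `|∂_ω S|` in number (each such point carries its own boundary edge);
* `lowBoundary_subset_halfBad` — **covering**: if `ω ⊆ E(ℤ^d)`, `S ∋ a` is open-connected,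
  `|S| > |B̃_0|` and `2 · 5^d · |∂_ω S| ≤ m₀(|S|)`, then the block surface of `S` is a `★`-connected
  set of `m ≥ m₀(|S|)` blocks, anchored on the ray from the block of `a`, at least half of whose
  blocks are bad (all but the `≤ 5^d |∂_ω S|` blocks within sup-distance `2` of an exit point,
  by `Pete.mem_badBlock_of_openConn`);
* `exists_badAtOrigin_le` — for `d ≥ 2` and `p > p_c` the bad-block probability is eventually
  small (`d = 2`: `Pete.badAtOrigin_small_two`; `d ≥ 3`: `KestenZhang.real_NoArm_le` and
  `KestenZhang.twoArms_small`);
* `real_lowBoundary_le`, `real_lowBoundary_le_exp` — **the Peierls sum** over half-bad anchored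
  star animals (`measureReal_exists_starAnimal_halfBad_le_ray`): with one block size `N₀(p)`,
  for every `M > |B̃_0|` and every anchor `a`,
  `P_p(∃ S ∋ a open-connected, |S| ≥ M, 2·5^d |∂_ω S| ≤ m₀(|S|)) ≤ K exp(-c M^{(d-1)/d})`.

Corollary 1.3 (the named fact `Pete2008_cor13` of `SupercriticalIsoperimetricProfile.lean`) is
derived from `real_lowBoundary_le_exp` in `SupercriticalIsoperimetricProfileDischarge.lean`
(union over the anchors of `[-n,n]^d` and Borel–Cantelli).

## References

* G. Pete, Electron. Commun. Probab. 13 (2008) 377–392, §§2–3 [Pete2008].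
* G. Grimmett, *Percolation*, 2nd ed., Springer 1999, §8.6 pp. 222–223 [GrimmettPercolation1999].
-/

noncomputable section

namespace Literature.Probability.Percolation

namespace Pete

open MeasureTheory LatticeModels SimpleGraph Filter Finset KestenZhang
open scoped ENNReal _root_.Topology

variable {d : ℕ}

/-! ## Counting: blocks near a point, exit points of a set -/

/-- At most `5^d` points of any finite set lie at sup-distance `≤ 2` from a given point.
[folklore] -/
private theorem card_filter_supDist_le_two (Y : Finset (Site d)) (x : Site d) :
    #(Y.filter fun b => supDist x b ≤ 2) ≤ 5 ^ d := by
  classical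
  have hsub : (Y.filter fun b => supDist x b ≤ 2) ⊆ (box d 2).image fun t => x + t := by
    intro b hb
    have h2 := (mem_filter.1 hb).2
    refine mem_image.2 ⟨b - x, ?_, by abel⟩
    rw [mem_box]
    intro i
    have hi := (supDist_le_iff.1 h2) i
    simp only [Pi.sub_apply]
    omega
  calc #(Y.filter fun b => supDist x b ≤ 2) ≤ #((box d 2).image fun t => x + t) := card_le_card hsub
    _ ≤ #(box d 2) := card_image_le
    _ = 5 ^ d := by rw [card_box]

/-- **Exit points are controlled by the open edge boundary.** For a finite set `S` and a
configuration `ω`, the points `w ∈ S` carrying an open edge `s(w, v) ∈ ω` of `ℤ^d` with `v ∉ S`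
number at most `|(∂S) ∩ ω|` (the map `w ↦ s(w, v_w)` is injective, `w` being the unique endpoint
in `S`). [folklore] -/
private theorem card_exitPoints_le_ncard (S : Finset (Site d)) (ω : BondConfig (Site d))
    [DecidablePred fun w : Site d => ∃ v : Site d, v ∉ S ∧ (zdGraph d).Adj w v ∧ s(w, v) ∈ ω] :
    #(S.filter fun w => ∃ v : Site d, v ∉ S ∧ (zdGraph d).Adj w v ∧ s(w, v) ∈ ω) ≤
      (((edgeBoundary (zdGraph d) S : Finset (Sym2 (Site d))) : Set (Sym2 (Site d))) ∩ ω).ncard := by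
  classical
  set F := S.filter fun w => ∃ v : Site d, v ∉ S ∧ (zdGraph d).Adj w v ∧ s(w, v) ∈ ω with hF
  set T : Finset (Sym2 (Site d)) := (edgeBoundary (zdGraph d) S).filter fun e => e ∈ ω with hT
  have hTset : ((T : Set (Sym2 (Site d)))) = ((edgeBoundary (zdGraph d) S : Finset (Sym2 (Site d))) : Set _) ∩ ω := by
    ext e; simp [hT]
  rw [← hTset, Set.ncard_coe_finset]
  -- the injection `w ↦ s(w, v_w)`
  set g : Site d → Sym2 (Site d) := fun w =>
    if h : ∃ v : Site d, v ∉ S ∧ (zdGraph d).Adj w v ∧ s(w, v) ∈ ω then s(w, h.choose) else s(w, w) with hg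
  have hgw : ∀ w ∈ F, ∃ v : Site d, v ∉ S ∧ (zdGraph d).Adj w v ∧ s(w, v) ∈ ω ∧ g w = s(w, v) := by
    intro w hw
    have h := (mem_filter.1 hw).2
    refine ⟨h.choose, h.choose_spec.1, h.choose_spec.2.1, h.choose_spec.2.2, ?_⟩
    simp only [hg, dif_pos h]
  refine card_le_card_of_injOn g (fun w hw => ?_) (fun w hw w' hw' heq => ?_)
  · obtain ⟨v, hvS, hadj, hvω, hgv⟩ := hgw w (mem_coe.1 hw)
    have hwS : w ∈ S := (mem_filter.1 (mem_coe.1 hw)).1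
    rw [hgv]
    refine mem_coe.2 (mem_filter.2 ⟨?_, hvω⟩)
    rw [mem_edgeBoundary_iff]
    exact ⟨(zdGraph d).mem_edgeSet.2 hadj, ⟨w, hwS, Sym2.mem_mk_left _ _⟩, ⟨v, hvS, Sym2.mem_mk_right _ _⟩⟩
  · obtain ⟨v, hvS, -, -, hgv⟩ := hgw w (mem_coe.1 hw)
    obtain ⟨v', hv'S, -, -, hgv'⟩ := hgw w' (mem_coe.1 hw')
    have hwS : w ∈ S := (mem_filter.1 (mem_coe.1 hw)).1
    rw [hgv, hgv'] at heq
    rcases Sym2.eq_iff.1 heq with ⟨h, -⟩ | ⟨h, -⟩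
    · exact h
    · exact absurd (h ▸ hwS) hv'S

/-! ## The threshold `m₀` -/

/-- `m₀(n)` is monotone in `n`. [folklore] -/
private theorem mZero_mono {N₀ n n' : ℕ} (h : n ≤ n') : mZero d N₀ n ≤ mZero d N₀ n' := by
  unfold mZero
  refine Nat.ceil_mono ?_
  have hexp : 0 ≤ ((d : ℝ) - 1) / d := by
    rcases Nat.eq_zero_or_pos d with hd | hd
    · subst hd; simp
    · exact div_nonneg (by norm_num; omega) (Nat.cast_nonneg d)
  have hN : (0 : ℝ) < (2 * N₀ + 1 : ℝ) ^ d := by positivity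
  rcases Nat.eq_zero_or_pos d with hd | hd
  · subst hd; simp
  · refine div_le_div_of_nonneg_right ?_ (by positivity)
    exact Real.rpow_le_rpow (by positivity) (by gcongr) hexp

/-- `j • e₀` added to a block: `b + j • e_{i} = b + Pi.single i j`. [folklore] -/
private theorem add_smul_single (hd : 1 ≤ d) (b : Site d) (j : ℕ) :
    b + (j : ℤ) • Pi.single (dir0 hd) (1 : ℤ) = b + Pi.single (dir0 hd) (j : ℤ) := by
  congr 1
  have := zero_add_smul_single hd j
  rwa [zero_add] at this

/-! ## Covering the low-boundary event by half-bad block surfaces -/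

/-- **Covering lemma** (Pete 2008, §2, "a colored block is never good", with the open edges
leaving `S` as the only exceptions). Let `ω ⊆ E(ℤ^d)` and let `S ∋ a` be a finite open-connected
set with `|S| ≥ M > |B̃_0|` and `2 · 5^d · |∂_ω S| ≤ m₀(|S|)`, where `∂_ω S` is the set of open
edges of `ℤ^d` with exactly one endpoint in `S`. Then for `m = #(blockSurface N₀ S) ≥ m₀(M)` the
block surface is a `★`-connected set of `m` blocks through a block `blk a + j e₀`, `j ≤ m`, and
the blocks of the surface at sup-distance `> 2` from every exit point of `S` — at least `m/2` of
them — are all bad. [cite: Pete2008, §2 (proof of Theorem 1.2)] -/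
theorem lowBoundary_subset_halfBad (hd : 2 ≤ d) (N₀ M : ℕ) (hM : (bigBox d N₀).card < M) (a : Site d) :
    {ω : BondConfig (Site d) | ω ⊆ (zdGraph d).edgeSet ∧ ∃ S : Finset (Site d), a ∈ S ∧ M ≤ #S ∧
        (∀ x ∈ S, ∀ y ∈ S, ω ∈ openConnIn (↑S : Set (Site d)) x y) ∧
        2 * 5 ^ d * (((edgeBoundary (zdGraph d) S : Finset (Sym2 (Site d))) : Set (Sym2 (Site d))) ∩ ω).ncard ≤
          mZero d N₀ #S} ⊆
      ⋃ k : ℕ, ⋃ j ∈ range (mZero d N₀ M + k + 1),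
        ⋃ Y ∈ starAnimals (blk N₀ a + (j : ℤ) • Pi.single (dir0 (by omega : 1 ≤ d)) (1 : ℤ)) (mZero d N₀ M + k),
          ⋃ Y' ∈ Y.powerset.filter (fun Y' => mZero d N₀ M + k ≤ 2 * Y'.card), ⋂ b ∈ Y', badBlock N₀ b := by
  classical
  rintro ω ⟨hω, S, haS, hMS, hconn, hbd⟩
  -- lattice walks from `a` inside `S`
  have hwalk : ∀ x ∈ S, ∃ W : (zdGraph d).Walk a x, ∀ v ∈ W.support, v ∈ S := by
    intro x hx
    obtain ⟨W, hWS, -⟩ := exists_walk_of_mem_openConnIn hω (hconn a haS x hx)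
    exact ⟨W, fun v hv => mem_coe.1 (hWS v hv)⟩
  -- the anchor
  obtain ⟨j, -, hjm, hjmem⟩ := exists_anchor_blockSurface_of_mem hd N₀ haS
  set Sig := blockSurface N₀ S with hSig
  set m := #Sig with hm
  -- size of the surface
  have hm₀S : mZero d N₀ #S ≤ m := by
    have h := rpow_le_card_blockSurface_of_mem hd N₀ haS (le_refl #S)
    refine Nat.ceil_le.2 ?_
    rw [div_le_iff₀ (by norm_cast; omega : (0 : ℝ) < d)]
    rw [hm, hSig]
    linarith
  have hm₀M : mZero d N₀ M ≤ m := (mZero_mono hMS).trans hm₀S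
  -- the exit points and the exceptional blocks
  set F := S.filter fun w => ∃ v : Site d, v ∉ S ∧ (zdGraph d).Adj w v ∧ s(w, v) ∈ ω with hF
  have hFcard : #F ≤ (((edgeBoundary (zdGraph d) S : Finset (Sym2 (Site d))) : Set (Sym2 (Site d))) ∩ ω).ncard := by
    rw [hF]; convert card_exitPoints_le_ncard S ω
  set Y' := Sig.filter fun b => ¬ ∃ w ∈ F, supDist (blk N₀ w) b ≤ 2 with hY'
  have hExc : #(Sig.filter fun b => ∃ w ∈ F, supDist (blk N₀ w) b ≤ 2) ≤ 5 ^ d * #F := by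
    calc #(Sig.filter fun b => ∃ w ∈ F, supDist (blk N₀ w) b ≤ 2)
        ≤ #(F.biUnion fun w => Sig.filter fun b => supDist (blk N₀ w) b ≤ 2) := by
          refine card_le_card fun b hb => ?_
          obtain ⟨hbS, w, hwF, hwb⟩ := mem_filter.1 hb
          exact mem_biUnion.2 ⟨w, hwF, mem_filter.2 ⟨hbS, hwb⟩⟩
      _ ≤ ∑ w ∈ F, #(Sig.filter fun b => supDist (blk N₀ w) b ≤ 2) := card_biUnion_le
      _ ≤ ∑ _w ∈ F, 5 ^ d := sum_le_sum fun w _ => card_filter_supDist_le_two Sig (blk N₀ w)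
      _ = 5 ^ d * #F := by rw [sum_const, smul_eq_mul, mul_comm]
  have hY'card : m ≤ 2 * #Y' := by
    have hsplit : #(Sig.filter fun b => ∃ w ∈ F, supDist (blk N₀ w) b ≤ 2) + #Y' = m := by
      rw [hY', hm]
      convert card_filter_add_card_filter_not (s := Sig) (fun b => ∃ w ∈ F, supDist (blk N₀ w) b ≤ 2)
    have h2 : 2 * (5 ^ d * #F) ≤ m := by
      calc 2 * (5 ^ d * #F) = 2 * 5 ^ d * #F := by ring
        _ ≤ 2 * 5 ^ d * (((edgeBoundary (zdGraph d) S : Finset (Sym2 (Site d))) : Set (Sym2 (Site d))) ∩ ω).ncard :=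
            Nat.mul_le_mul_left _ hFcard
        _ ≤ mZero d N₀ #S := hbd
        _ ≤ m := hm₀S
    omega
  -- membership in the union
  refine Set.mem_iUnion.2 ⟨m - mZero d N₀ M, ?_⟩
  rw [show mZero d N₀ M + (m - mZero d N₀ M) = m by omega]
  refine Set.mem_iUnion₂.2 ⟨j, mem_range.2 (by omega), Set.mem_iUnion₂.2 ⟨Sig, ?_, ?_⟩⟩
  · rw [add_smul_single]
    exact mem_starAnimals hjmem (starConn_blockSurface_of_mem hd N₀ hwalk)
  · refine Set.mem_iUnion₂.2 ⟨Y', mem_filter.2 ⟨mem_powerset.2 (filter_subset _ _), hY'card⟩, ?_⟩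
    refine Set.mem_iInter₂.2 fun b hb => ?_
    obtain ⟨hbSig, hbfar⟩ := mem_filter.1 hb
    obtain ⟨hbS, x', hx', hx'b⟩ := blockSurface_spec hd hbSig
    obtain ⟨c, hc, rfl⟩ := mem_image.1 hx'
    refine mem_badBlock_of_openConn hω S hconn b (fun y hy hyb => hbS ?_) ⟨c, hc, hx'b⟩ (by omega) ?_
    · exact mem_image.2 ⟨y, hy, hyb⟩
    · intro w hw v hv hadj he
      by_contra hle
      push Not at hle
      exact hbfar ⟨w, mem_filter.2 ⟨hw, v, hv, hadj, he⟩, hle⟩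

/-! ## The block estimate in every dimension `d ≥ 2` -/

/-- **The bad-block probability is eventually small**, `d ≥ 2`, `p > p_c(ℤ^d)`: for every
`ε > 0` some block size `N₀` has `P_p(badAtOrigin N₀) ≤ ε` (Pete 2008 §2: "the probability that a
given block is good tends to `1` as `N → ∞` [Grimm]"; `d = 2` by the planar estimate
`badAtOrigin_small_two`, `d ≥ 3` by GKZ Lemma 5 and Grimmett's Lemma (7.89)).
[cite: Pete2008, §2 (basic result of static renormalization)] -/
theorem exists_badAtOrigin_le (hd : 2 ≤ d) (p : unitInterval) (hp : criticalProb (zdGraph d) (0 : Site d) < (p : ℝ))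
    {ε : ℝ} (hε : 0 < ε) :
    ∃ N₀ : ℕ, (bondPercolation (zdGraph d) p).real (badAtOrigin (d := d) N₀) ≤ ε := by
  rcases Nat.lt_or_ge d 3 with hd3 | hd3
  · obtain rfl : d = 2 := by omega
    obtain ⟨N₁, hN₁⟩ := badAtOrigin_small_two p hp ε hε
    exact ⟨N₁, hN₁ N₁ le_rfl⟩
  · obtain ⟨γ, hγ, hNoArm⟩ := real_NoArm_le hd3 p hp
    obtain ⟨N₁, hN₁⟩ := twoArms_small hd3 p hp (ε / 2) (by positivity)
    have hev : ∀ᶠ N₀ : ℕ in atTop, Real.exp (-(γ * N₀)) ≤ ε / 2 := by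
      have ht : Tendsto (fun N₀ : ℕ => Real.exp (-(γ * N₀))) atTop (𝓝 0) := by
        refine Real.tendsto_exp_atBot.comp ?_
        refine tendsto_neg_atTop_atBot.comp ?_
        exact Tendsto.const_mul_atTop hγ tendsto_natCast_atTop_atTop
      exact ht.eventually (ge_mem_nhds (by positivity))
    obtain ⟨N₂, hN₂⟩ := eventually_atTop.1 hev
    refine ⟨max N₁ N₂, ?_⟩
    calc (bondPercolation (zdGraph d) p).real (badAtOrigin (max N₁ N₂))
        ≤ (bondPercolation (zdGraph d) p).real (NoArm (max N₁ N₂)) +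
            (bondPercolation (zdGraph d) p).real (TwoArms (max N₁ N₂)) := measureReal_union_le _ _
      _ ≤ ε / 2 + ε / 2 :=
          add_le_add ((hNoArm _).trans (hN₂ _ (le_max_right _ _))) (hN₁ _ (le_max_left _ _))
      _ = ε := by ring

/-! ## The Peierls sum -/

/-- **The Peierls sum over half-bad surfaces** (Pete 2008, §2). If
`P_p(badAtOrigin N₀) ≤ (η²)^{5^d}` with `0 < η ≤ 1` and `4(3^d+1)² η ≤ ½`, then for every
`M > |B̃_0|` and every anchor `a`,
`P_p(ω ⊆ E, ∃ S ∋ a open-connected, |S| ≥ M, 2·5^d |∂_ω S| ≤ m₀(|S|))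
  ≤ 2 (η^{2(5^d-1)})⁻¹ (½)^{m₀(M)}`. [cite: Pete2008, §2 (proof of Theorem 1.2, Peierls argument)] -/
theorem real_lowBoundary_le (hd : 2 ≤ d) (p : unitInterval) (N₀ : ℕ) {η : ℝ} (hη0 : 0 < η) (hη1 : η ≤ 1)
    (hq : (bondPercolation (zdGraph d) p).real (badAtOrigin (d := d) N₀) ≤ (η ^ 2) ^ 5 ^ d)
    (hρ : 4 * (3 ^ d + 1 : ℝ) ^ 2 * η ≤ 1 / 2) (M : ℕ) (hM : (bigBox d N₀).card < M) (a : Site d) :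
    (bondPercolation (zdGraph d) p).real
        {ω : BondConfig (Site d) | ω ⊆ (zdGraph d).edgeSet ∧ ∃ S : Finset (Site d), a ∈ S ∧ M ≤ #S ∧
          (∀ x ∈ S, ∀ y ∈ S, ω ∈ openConnIn (↑S : Set (Site d)) x y) ∧
          2 * 5 ^ d * (((edgeBoundary (zdGraph d) S : Finset (Sym2 (Site d))) : Set (Sym2 (Site d))) ∩ ω).ncard ≤
            mZero d N₀ #S} ≤
      2 * (η ^ (2 * ((4 + 1) ^ d - 1)))⁻¹ * (1 / 2 : ℝ) ^ mZero d N₀ M := by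
  set μ := bondPercolation (zdGraph d) p with hμ
  set ρ : ℝ := 4 * (3 ^ d + 1 : ℝ) ^ 2 * η with hρdef
  set R : ℕ := (4 + 1) ^ d - 1 with hR
  set K : ℝ := (η ^ (2 * R))⁻¹ with hK
  have hK0 : 0 ≤ K := by positivity
  have hρ0 : 0 ≤ ρ := by positivity
  have hρ1 : ρ < 1 := by linarith
  set m₀ := mZero d N₀ M with hm₀def
  have hd1 : 1 ≤ d := by omega
  have hδ0 : (0 : ℝ) ≤ η ^ 2 := by positivity
  have hδ1 : η ^ 2 ≤ 1 := pow_le_one₀ hη0.le hη1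
  -- one surface size
  have hF : ∀ m : ℕ, μ.real (⋃ j ∈ range (m + 1),
      ⋃ Y ∈ starAnimals (blk N₀ a + (j : ℤ) • Pi.single (dir0 hd1) (1 : ℤ)) m,
        ⋃ Y' ∈ Y.powerset.filter (fun Y' => m ≤ 2 * Y'.card), ⋂ b ∈ Y', badBlock N₀ b) ≤ K * ρ ^ m := by
    intro m
    have h := measureReal_exists_starAnimal_halfBad_le_ray (μ := μ) (badBlock N₀) hδ0 hδ1
      (real_biInter_badBlock_le p N₀ hq) (blk N₀ a) (Pi.single (dir0 hd1) (1 : ℤ)) m m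
    refine h.trans ?_
    have h2 := halfBad_summand_le_geometric d R hη0 hη1 m
    rw [hK, hρdef]
    convert h2 using 3
  have hsum : HasSum (fun k : ℕ => K * ρ ^ (m₀ + k)) (K * ρ ^ m₀ / (1 - ρ)) := by
    have h := (hasSum_geometric_of_lt_one hρ0 hρ1).mul_left (K * ρ ^ m₀)
    have h' : (fun k : ℕ => K * ρ ^ (m₀ + k)) = fun i : ℕ => K * ρ ^ m₀ * ρ ^ i := by
      funext k; rw [pow_add]; ring
    rw [h', div_eq_mul_inv]; exact h
  have hcover := lowBoundary_subset_halfBad hd N₀ M hM a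
  have hEle : μ {ω : BondConfig (Site d) | ω ⊆ (zdGraph d).edgeSet ∧ ∃ S : Finset (Site d), a ∈ S ∧ M ≤ #S ∧
          (∀ x ∈ S, ∀ y ∈ S, ω ∈ openConnIn (↑S : Set (Site d)) x y) ∧
          2 * 5 ^ d * (((edgeBoundary (zdGraph d) S : Finset (Sym2 (Site d))) : Set (Sym2 (Site d))) ∩ ω).ncard ≤
            mZero d N₀ #S} ≤ ENNReal.ofReal (K * ρ ^ m₀ / (1 - ρ)) := by
    refine (measure_mono hcover).trans ?_
    refine (measure_iUnion_le _).trans ?_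
    calc ∑' k, μ (⋃ j ∈ range (mZero d N₀ M + k + 1),
            ⋃ Y ∈ starAnimals (blk N₀ a + (j : ℤ) • Pi.single (dir0 hd1) (1 : ℤ)) (mZero d N₀ M + k),
              ⋃ Y' ∈ Y.powerset.filter (fun Y' => mZero d N₀ M + k ≤ 2 * Y'.card), ⋂ b ∈ Y', badBlock N₀ b)
        ≤ ∑' k, ENNReal.ofReal (K * ρ ^ (m₀ + k)) := by
          refine ENNReal.tsum_le_tsum fun k => ?_
          rw [← ofReal_measureReal (measure_ne_top _ _)]
          exact ENNReal.ofReal_le_ofReal (hF _)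
      _ = ENNReal.ofReal (K * ρ ^ m₀ / (1 - ρ)) := by
          rw [← ENNReal.ofReal_tsum_of_nonneg (fun k => by positivity) hsum.summable, hsum.tsum_eq]
  have h1ρ : 0 < 1 - ρ := by linarith
  have hreal : μ.real {ω : BondConfig (Site d) | ω ⊆ (zdGraph d).edgeSet ∧ ∃ S : Finset (Site d), a ∈ S ∧ M ≤ #S ∧
          (∀ x ∈ S, ∀ y ∈ S, ω ∈ openConnIn (↑S : Set (Site d)) x y) ∧
          2 * 5 ^ d * (((edgeBoundary (zdGraph d) S : Finset (Sym2 (Site d))) : Set (Sym2 (Site d))) ∩ ω).ncard ≤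
            mZero d N₀ #S} ≤ K * ρ ^ m₀ / (1 - ρ) := by
    rw [measureReal_def]
    have := ENNReal.toReal_mono ENNReal.ofReal_ne_top hEle
    rwa [ENNReal.toReal_ofReal (div_nonneg (by positivity) h1ρ.le)] at this
  refine hreal.trans ?_
  have hρhalf : ρ ^ m₀ ≤ (1 / 2 : ℝ) ^ m₀ := pow_le_pow_left₀ hρ0 hρ m₀
  have h2 : 1 / (1 - ρ) ≤ 2 := by rw [div_le_iff₀ h1ρ]; linarith
  calc K * ρ ^ m₀ / (1 - ρ) = K * ρ ^ m₀ * (1 / (1 - ρ)) := by ring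
    _ ≤ K * (1 / 2 : ℝ) ^ m₀ * 2 := by gcongr
    _ = 2 * K * (1 / 2 : ℝ) ^ m₀ := by ring

/-- `(½)^{m₀(M)} ≤ exp(-c M^{(d-1)/d})` with `c = log 2 / (d ((2N₀+1)^d)^{(d-1)/d}) > 0`.
[folklore] -/
private theorem half_pow_mZero_le_exp (hd : 1 ≤ d) (N₀ M : ℕ) :
    (1 / 2 : ℝ) ^ mZero d N₀ M ≤
      Real.exp (-(Real.log 2 / (d * (((2 * N₀ + 1 : ℝ) ^ d) ^ (((d : ℝ) - 1) / d))) * (M : ℝ) ^ (((d : ℝ) - 1) / d))) := by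
  set a : ℝ := ((d : ℝ) - 1) / d with ha
  set B : ℝ := ((2 * N₀ + 1 : ℝ) ^ d) ^ a with hB
  have hdpos : (0 : ℝ) < d := by norm_cast
  have hB0 : 0 < B := by positivity
  have hx : ((M : ℝ) / ((2 * N₀ + 1 : ℝ) ^ d)) ^ a / d ≤ mZero d N₀ M := Nat.le_ceil _
  have hxeq : ((M : ℝ) / ((2 * N₀ + 1 : ℝ) ^ d)) ^ a / d = (M : ℝ) ^ a / (d * B) := by
    rw [hB, Real.div_rpow (Nat.cast_nonneg M) (by positivity) a]
    field_simp
  rw [show (1 / 2 : ℝ) ^ mZero d N₀ M = Real.exp (-(Real.log 2 * mZero d N₀ M)) by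
    rw [neg_mul_eq_mul_neg, Real.exp_mul, Real.exp_log two_pos, one_div, Real.rpow_neg two_pos.le,
      Real.rpow_natCast, inv_pow]]
  rw [Real.exp_le_exp, neg_le_neg_iff]
  calc Real.log 2 / (d * B) * (M : ℝ) ^ a = Real.log 2 * ((M : ℝ) ^ a / (d * B)) := by ring
    _ ≤ Real.log 2 * mZero d N₀ M := by
        rw [← hxeq]
        exact mul_le_mul_of_nonneg_left hx (Real.log_nonneg one_le_two)

/-- **Pete 2008, Theorem 1.2 in the tree's rendering (one anchor, one block size).** For `d ≥ 2`
and `p > p_c(ℤ^d)` there are a block size `N₀` and constants `K`, `c > 0` such that for every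
`M > |B̃_0| = (10N₀+5)^d` and every `a ∈ ℤ^d`,
`P_p(ω ⊆ E(ℤ^d) ∧ ∃ S ∋ a finite open-connected, |S| ≥ M, 2·5^d·|∂_ω S| ≤ m₀(|S|))
  ≤ K exp(-c M^{(d-1)/d})`,
where `m₀(s) = ⌈(s/(2N₀+1)^d)^{(d-1)/d}/d⌉` and `∂_ω S` is the set of open edges of `ℤ^d` with
exactly one endpoint in `S` ("`|∂⁺_𝒞 S| ≤ α|S|^{1-1/d}` is exponentially unlikely in
`|S|^{1-1/d}`"). [cite: Pete2008, Thm. 1.2] -/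
theorem real_lowBoundary_le_exp (hd : 2 ≤ d) (p : unitInterval) (hp : criticalProb (zdGraph d) (0 : Site d) < (p : ℝ)) :
    ∃ N₀ : ℕ, ∃ K c : ℝ, 0 < c ∧ ∀ M : ℕ, (bigBox d N₀).card < M → ∀ a : Site d,
      (bondPercolation (zdGraph d) p).real
          {ω : BondConfig (Site d) | ω ⊆ (zdGraph d).edgeSet ∧ ∃ S : Finset (Site d), a ∈ S ∧ M ≤ #S ∧
            (∀ x ∈ S, ∀ y ∈ S, ω ∈ openConnIn (↑S : Set (Site d)) x y) ∧
            2 * 5 ^ d * (((edgeBoundary (zdGraph d) S : Finset (Sym2 (Site d))) : Set (Sym2 (Site d))) ∩ ω).ncard ≤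
              mZero d N₀ #S} ≤
        K * Real.exp (-(c * (M : ℝ) ^ (((d : ℝ) - 1) / d))) := by
  -- the target `η`, making `ρ = 1/2`
  set η : ℝ := 1 / (8 * (3 ^ d + 1 : ℝ) ^ 2) with hη
  have hη0 : 0 < η := by positivity
  have hη1 : η ≤ 1 := by
    rw [hη, div_le_one (by positivity)]
    have : (1 : ℝ) ≤ (3 ^ d + 1 : ℝ) ^ 2 := one_le_pow₀ (by norm_num)
    linarith
  have hρ : 4 * (3 ^ d + 1 : ℝ) ^ 2 * η ≤ 1 / 2 := by
    rw [hη]; field_simp; norm_num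
  obtain ⟨N₀, hq⟩ := exists_badAtOrigin_le hd p hp (ε := (η ^ 2) ^ 5 ^ d) (by positivity)
  have hd1 : 1 ≤ d := by omega
  refine ⟨N₀, 2 * (η ^ (2 * ((4 + 1) ^ d - 1)))⁻¹,
    Real.log 2 / (d * (((2 * N₀ + 1 : ℝ) ^ d) ^ (((d : ℝ) - 1) / d))), by positivity, fun M hM a => ?_⟩
  refine (real_lowBoundary_le hd p N₀ hη0 hη1 hq hρ M hM a).trans ?_
  exact mul_le_mul_of_nonneg_left (half_pow_mZero_le_exp hd1 N₀ M) (by positivity)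

end Pete

end Literature.Probability.Percolation

end
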